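import Mathlib.AlgebraicGeometry.Morphisms.Flat
import Mathlib.RingTheory.Flat.FaithfullyFlat.Algebra
import HarnessLib

/-!
# Reducedness descends along a flat surjective morphism

If `f : X ⟶ Y` is flat and surjective and `X` is reduced, then `Y` is reduced
(`isReduced_of_flat_of_surjective`; Stacks Tag 0C0R / EGA IV₂ 2.1.13 for faithfully flat
descent of reducedness). Proof on stalks: for `y = f x`, `𝒪_{Y,y} → 𝒪_{X,x}` is a flat local
homomorphism of local rings, hence faithfully flat and in particular injective
(`Module.FaithfullyFlat.of_flat_of_isLocalHom`), and `𝒪_{X,x}` is reduced.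

Used for the quotient of an abelian variety by a finite subgroup (the kernel pairs along which
the group law is descended are reduced).

## References

* [StacksProject, Tag 033E] (descending properties: reduced), cf. Tag 0C0R; EGA IV₂, Prop. 2.1.13.
-/

universe u

open CategoryTheory AlgebraicGeometry

namespace Literature.AlgebraicGeometry.Morphisms

/-- **Reducedness descends along flat surjective morphisms**: if `f : X ⟶ Y` is flat and
surjective and `X` is reduced, so is `Y` (stalkwise, a flat local homomorphism being faithfully
flat, hence injective). (Stacks Tag 033E; EGA IV₂, 2.1.13.) [cite: StacksProject, Tag 033E] -/
theorem isReduced_of_flat_of_surjective {X Y : Scheme.{u}} (f : X ⟶ Y) [Flat f] [Surjective f]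
    [IsReduced X] : IsReduced Y := by
  refine @isReduced_of_isReduced_stalk Y fun y ↦ ?_
  obtain ⟨x, rfl⟩ := f.surjective y
  let ψ := f.stalkMap x
  have hψ : ψ.hom.Flat := Flat.stalkMap f x
  algebraize [ψ.hom]
  have : IsLocalHom (algebraMap (Y.presheaf.stalk (f x)) (X.presheaf.stalk x)) :=
    inferInstanceAs (IsLocalHom (f.stalkMap x).hom)
  have : Module.FaithfullyFlat (Y.presheaf.stalk (f x)) (X.presheaf.stalk x) :=
    Module.FaithfullyFlat.of_flat_of_isLocalHom
  have hinj : Function.Injective (algebraMap (Y.presheaf.stalk (f x)) (X.presheaf.stalk x)) :=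
    FaithfulSMul.algebraMap_injective _ _
  exact isReduced_of_injective _ hinj

end Literature.AlgebraicGeometry.Morphisms
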